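import Summits.CriticalPhenomena.Ising3DConformalLimit.Theses.PlantedPinning

/-!
# CriticalPhenomena / Ising3DConformalLimit — route PlantedPinning, assembly

Settles item `stmt-CriticalPhenomena-8456` (rank 1, assembly of route
`route-CriticalPhenomena-PlantedPinning`):

`PinningEfficiencyDeficit → GaussianPinningSaturation → MoebiusLimitExists → Ising3DConformalLimit`.

Pure logic over the summit's structure predicates
(`Literature/Probability/LatticeModels/ScalingLimit3D.lean`): `MoebiusLimitExists` supplies
`ρ, Δ, S` with positivity of `ρ` on `(0,1]`, `0 < Δ`, the pointwise scaling limit,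
non-degeneracy of the two-point function and Möbius covariance, i.e. every hypothesis of
`GaussianPinningSaturation` except `¬ HasNontrivialU4 S`. If `HasNontrivialU4 S` failed,
saturation at tolerance `ε/2` and the deficit at tolerance `ε` both apply at the common pin
density `p = min p₀ p₁ / 2` and box size `L = max L₀ L₁`, giving `1 - ε/2 ≤ e_L ≤ 1 - ε` with
`ε > 0` — a contradiction. Hence `HasNontrivialU4 S`, and `⟨ρ, Δ, S, …⟩` witnesses the conjunct
`Ising3DConformalLimit` (= `CritIsing3DConformalLimit`). Same argument as the route's deciding
theorem `closes`. No named facts are used; the theorem is unconditional bookkeeping.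
-/

namespace Summit.CriticalPhenomena.Ising3DConformalLimit.Theorems

open Summit.CriticalPhenomena.Ising3DConformalLimit.Theses.PlantedPinning

/-- Settles `stmt-CriticalPhenomena-8456` (exact signature): the assembly
`PinningEfficiencyDeficit → GaussianPinningSaturation → MoebiusLimitExists → Ising3DConformalLimit`
of route PlantedPinning. Proof: take `ρ, Δ, S` and the limit / non-degeneracy / Möbius clauses
from `MoebiusLimitExists`; clause (iii) `HasNontrivialU4 S` by contradiction — otherwise
`GaussianPinningSaturation` (with `ε/2`) and `PinningEfficiencyDeficit` (with `ε`) give, at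
`p = min p₀ p₁ / 2` and `L = max L₀ L₁`, both `1 - ε/2 ≤ e_L` and `e_L ≤ 1 - ε`, absurd for
`ε > 0`; pack the six clauses of `CritIsing3DConformalLimit`. [folklore] -/
theorem plantedPinning_assembly_proof :
    Summit.CriticalPhenomena.Ising3DConformalLimit.Theses.PlantedPinning.Assembly := by
  unfold Assembly
  intro hDef hSat hMoeb
  obtain ⟨ρ, Δ, S, hρ, hΔ, hlim, hnd, hmob⟩ := hMoeb
  refine ⟨ρ, Δ, S, hρ, hΔ, hlim, hnd, hmob, ?_⟩
  -- clause (iii) by contradiction: suppose U₄ ≡ 0 on non-coincident configurations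
  by_contra hU4
  obtain ⟨ε, hε, p₀, hp₀, hdef⟩ := hDef
  obtain ⟨p₁, hp₁, hsat⟩ := hSat ρ Δ S hρ hΔ hlim hnd hmob hU4 (ε / 2) (by linarith)
  have hmin : 0 < min p₀ p₁ := lt_min hp₀ hp₁
  have hle₀ : min p₀ p₁ ≤ p₀ := min_le_left p₀ p₁
  have hle₁ : min p₀ p₁ ≤ p₁ := min_le_right p₀ p₁
  -- common pin density p = min p₀ p₁ / 2 ∈ (0, p₀) ∩ (0, p₁)
  obtain ⟨L₀, hL₀⟩ := hdef (min p₀ p₁ / 2) (by linarith) (by linarith)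
  obtain ⟨L₁, hL₁⟩ := hsat (min p₀ p₁ / 2) (by linarith) (by linarith)
  -- common box size L = max L₀ L₁: deficit e ≤ 1 - ε and saturation 1 - ε/2 ≤ e collide
  have h₀ := hL₀ (max L₀ L₁) (le_max_left L₀ L₁)
  have h₁ := hL₁ (max L₀ L₁) (le_max_right L₀ L₁)
  linarith

end Summit.CriticalPhenomena.Ising3DConformalLimit.Theorems
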